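import Literature.NumberTheory.LFunctions.KMVFirstMomentBeyondDiagonal
import Mathlib.NumberTheory.LSeries.HurwitzZetaValues
import Literature.NumberTheory.EllipticCurves.HeckeOperatorsEigenvalueBoundProofs
import Literature.NumberTheory.EllipticCurves.NewformsFiniteProofs
import HarnessLib

/-!
# The mollifier method's POSITIVITY FLOOR: `‖L^h(P,Q)‖² ≤ (Σ^h 1) · Q^h(P,Q)` (Cauchy–Schwarz with the
# non-negative harmonic weights; Kowalski–Michel–VanderKam 2000, §1 (6) / §6 p. 19)

Topic `Literature/NumberTheory/LFunctions`, companion of `KMVHighDerivativeNonvanishing` (whose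
`KMV2000.LhPQ`, `KMV2000.QhPQ` it bounds). Typed AND PROVED for cell ls-idea: seat ls-idea-lens-6
gen 5, card §v8c (c2) «POSITIVITY FLOOR» (cards/ls-idea-lens-6.md sha16 4cb7251a27e8ad09 l.306–313),
sketch #8 `HOME/ls-idea-lens-6/Sketch_PositivityFloor.lean` sha16 a248851c5e7e0046 (118 lines, rc 0,
0 sorries); verdict ledger: referee C batch 49 PASS, referee A batch 43 PASS (ledger/audit note),
referee B batch 49 PASS ×4 with BN-14 rider «POSITIVITY FLOOR / COMPANION TEST» and B-CHECK of the
sketch CLEAN (STATUS 23:36:14Z: «hypothesis-free proved inequalities … empty family ⇒ 0 ≤ 0»). This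
file is the sketch VERBATIM (namespace `KMV2000`, abstract Cauchy–Schwarz helper made `private`,
citations added).

WHAT IS PRINTED. KMV 2000 p. 6, display (6): «By Cauchy–Schwarz, (5) implies that
`Σ^h_{f, Λ^{(k)}(f,1/2) ≠ 0} 1 ≥ (L^h_1)²/Q^h_1`»; p. 19: «At this point we are in position to apply
Cauchy's inequality to prove our main result» (Theorem 6.1, `Σ^h_{Q̃(Λ(f,s))(1/2) ≠ 0} 1 ≥ max R(P,Q)`).
The inequality below is the same Cauchy–Schwarz step over the WHOLE family (no restriction to the
non-vanishing set, so the first factor is the full harmonic mass `Σ^h_f 1 = Σ_f ω_f`):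

  `‖L^h(P,Q)‖² ≤ (Σ^h_f 1) · Q^h(P,Q)`     (every level `q`, every `P`, `Q`, `M`).

Combined with the tree's first display on the whole door window `0 < Δ' < 2` at `Q = 1`
(`KMV2000.firstDisplay_of_bettin`) and `Σ^h 1 = 1 + O(q^{-3/2+ε})` (`kmv2000_eq4`), this is the lower
bound («floor») on the observed normalised off-diagonal second-moment functional recorded in the card
§v8c (c2): `T₂^{obs}(q) ≥ ½·linForm(Δ',P,1)² − secondMomentForm(Δ',P,1) − o(1)` — that corollary is
NOT typed here (lens-6: «additionally needs `firstDisplay_of_bettin` + a `Σ^h 1` fact»).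

This file proves ONLY the kernel inequality (an abstract weighted Cauchy–Schwarz over a finite set,
specialised to `KMV2000.LhPQ` / `KMV2000.QhPQ`, weights `ω_f ≥ 0` by `harmonicWeight_nonneg_two`).
It is elementary bookkeeping. «The programme SEARCHES and TYPES; no exceptional-zero theorem (no
Landau–Siegel / Siegel-zero exclusion, no Theorem 1–2 of arXiv:2211.02515, no repaired Margin232) is
proved by ideation; typed ≠ proved» — here the typed inequality IS proved, and it asserts nothing
about zeros.

## References
* [KowalskiMichelVanderKam2000] E. Kowalski, P. Michel, J. VanderKam, J. reine angew. Math. 526 (2000)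
  1–34, §1 display (6) (p. 6), §6 p. 19 («Cauchy's inequality») and Theorem 6.1.
  [held: paper:doi-10-1515-crll-2000-074 p0006:L2–L12, p0019:L141, p0020:L1–L8]
* [IwaniecKowalski2004] H. Iwaniec, E. Kowalski, Analytic Number Theory, (14.11), (14.60), Cor. 14.24.
-/

noncomputable section

open scoped MatrixGroups Real
open CongruenceSubgroup Complex Finset Filter Polynomial
open Literature.NumberTheory.EllipticCurves.ModularForms

namespace Literature.NumberTheory.LFunctions.KMV2000

open Literature.NumberTheory.LFunctions Literature.NumberTheory.LFunctions.KMV2000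
  Literature.NumberTheory.LFunctions.GL2Family

/-- Abstract weighted Cauchy–Schwarz over a finite set: for non-negative real weights `w` and
complex values `a`, `‖Σ_{i∈s} w_i a_i‖² ≤ (Σ_{i∈s} w_i) · Σ_{i∈s} w_i ‖a_i‖²`. [folklore] -/
private theorem norm_sq_finsum_mem_weighted_le {α : Type*} {s : Set α} (hs : s.Finite)
    (w : α → ℝ) (hw : ∀ i ∈ s, 0 ≤ w i) (a : α → ℂ) :
    ‖∑ᶠ i ∈ s, (w i : ℂ) * a i‖ ^ 2 ≤
      (∑ᶠ i ∈ s, w i) * ∑ᶠ i ∈ s, w i * ‖a i‖ ^ 2 := by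
  rw [finsum_mem_eq_finite_toFinset_sum _ hs, finsum_mem_eq_finite_toFinset_sum _ hs, finsum_mem_eq_finite_toFinset_sum _ hs]
  set t := hs.toFinset with ht
  have hw' : ∀ i ∈ t, 0 ≤ w i := fun i hi ↦ hw i (hs.mem_toFinset.mp hi)
  have h1 : ‖∑ i ∈ t, (w i : ℂ) * a i‖ ≤ ∑ i ∈ t, w i * ‖a i‖ := by
    refine (norm_sum_le _ _).trans (le_of_eq ?_)
    refine Finset.sum_congr rfl fun i hi ↦ ?_
    rw [norm_mul, Complex.norm_real, Real.norm_of_nonneg (hw' i hi)]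
  have h0 : 0 ≤ ‖∑ i ∈ t, (w i : ℂ) * a i‖ := norm_nonneg _
  have h2 : (∑ i ∈ t, w i * ‖a i‖) ^ 2 ≤ (∑ i ∈ t, w i) * ∑ i ∈ t, w i * ‖a i‖ ^ 2 := by
    apply Finset.sum_sq_le_sum_mul_sum_of_sq_le_mul
    all_goals intro i hi
    all_goals first
      | exact hw' i hi
      | exact mul_nonneg (hw' i hi) (sq_nonneg _)
      | exact le_of_eq (by ring)
  calc ‖∑ i ∈ t, (w i : ℂ) * a i‖ ^ 2 ≤ (∑ i ∈ t, w i * ‖a i‖) ^ 2 :=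
        pow_le_pow_left₀ h0 h1 2
    _ ≤ (∑ i ∈ t, w i) * ∑ i ∈ t, w i * ‖a i‖ ^ 2 := h2

/-- The harmonic weight `ω_f = Γ(k−1)/((4π)^{k−1} Re⟨f,f⟩)` of `GL2Family.harmonicWeight` is
non-negative in weight `2` (`Γ(1) = 1 > 0`, `(4π)^1 > 0`, `Re⟨f,f⟩ ≥ 0` by
`re_peterssonProduct_self_nonneg_level`; a vanishing denominator gives the value `0`).
[cite: IwaniecKowalski2004, (14.60) with (14.11)] -/
theorem harmonicWeight_nonneg_two {N : ℕ} [NeZero N] (f : CuspForm (Gamma0 N) 2) :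
    0 ≤ harmonicWeight f := by
  rw [harmonicWeight_def]
  refine div_nonneg (Real.Gamma_pos_of_pos (by norm_num)).le (mul_nonneg ?_ ?_)
  · exact zpow_nonneg (by positivity) _
  · exact re_peterssonProduct_self_nonneg_level _ _ f

/-- **The positivity floor (kernel form).** For every level `q`, all real polynomials `P`, `Q` and
every mollifier length `M`:
`‖L^h(P,Q)‖² ≤ (Σ^h_{f} 1) · Σ^h_f |Q̃(Λ(f,s))(½) M_P(f)|²`, i.e. `‖LhPQ‖² ≤ (Σ_f ω_f) · Re QhPQ`
with both factors written as real `finsum`s over `newforms0 q 2`. Cauchy–Schwarz with the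
non-negative weights `ω_f` — the step printed as KMV 2000 (6) / «Cauchy's inequality» (p. 19), taken
over the whole family. [cite: KowalskiMichelVanderKam2000, §1 (6) p. 6 and §6 p. 19 (Cauchy's inequality)] -/
theorem norm_sq_LhPQ_le (q : ℕ) [NeZero q] (P Q : ℝ[X]) (M : ℝ) :
    ‖LhPQ q P Q M‖ ^ 2 ≤
      (∑ᶠ f ∈ newforms0 q 2, harmonicWeight f) *
        ∑ᶠ f ∈ newforms0 q 2, harmonicWeight f * ‖Qtilde q Q f * mollifierP q P M f‖ ^ 2 := by
  have hfin : (newforms0 q 2).Finite := finite_newforms0_holds q 2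
  unfold LhPQ GL2Family.harmonicSum
  exact norm_sq_finsum_mem_weighted_le hfin _ (fun f _ ↦ harmonicWeight_nonneg_two f) _

/-- The second factor of the floor IS the mollified second moment: `QhPQ q P Q M`, a harmonic sum of
the real numbers `|Q̃ M_P|²`, equals the real `finsum` `Σ_f ω_f ‖Q̃(f) M_P(f)‖²` cast to `ℂ`.
[cite: KowalskiMichelVanderKam2000, §6 p. 19 (Q^h(P,Q))] -/
theorem QhPQ_eq_ofReal (q : ℕ) [NeZero q] (P Q : ℝ[X]) (M : ℝ) :
    QhPQ q P Q M =
      ((∑ᶠ f ∈ newforms0 q 2, harmonicWeight f * ‖Qtilde q Q f * mollifierP q P M f‖ ^ 2 : ℝ) : ℂ) := by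
  have hfin : (newforms0 q 2).Finite := finite_newforms0_holds q 2
  unfold QhPQ GL2Family.harmonicSum
  rw [finsum_mem_eq_finite_toFinset_sum _ hfin, finsum_mem_eq_finite_toFinset_sum _ hfin]
  push_cast
  rfl

/-- The harmonic mass `Σ^h_f 1 = harmonicSum q 2 (fun _ ↦ 1)` is the real `finsum` `Σ_f ω_f` cast
to `ℂ` (so the first factor of the floor is `Re Σ^h 1`; Petersson at `m = n = 1` gives
`Σ^h 1 = 1 + O(q^{−3/2+ε})`, `GL2Family.petersson_trace_deviation`-type facts, not used here).
[cite: IwaniecKowalski2004, (14.60); Cor. 14.24] -/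
theorem harmonicSum_one_eq_ofReal (q : ℕ) [NeZero q] :
    GL2Family.harmonicSum q 2 (fun _ ↦ (1 : ℂ)) =
      ((∑ᶠ f ∈ newforms0 q 2, harmonicWeight f : ℝ) : ℂ) := by
  have hfin : (newforms0 q 2).Finite := finite_newforms0_holds q 2
  unfold GL2Family.harmonicSum
  rw [finsum_mem_eq_finite_toFinset_sum _ hfin, finsum_mem_eq_finite_toFinset_sum _ hfin]
  push_cast
  simp

/-- **The floor in `Re`-form**: `‖LhPQ q P Q M‖² ≤ Re(Σ^h 1) · Re(QhPQ q P Q M)` (both factors are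
real: `harmonicSum_one_eq_ofReal`, `QhPQ_eq_ofReal`).
[cite: KowalskiMichelVanderKam2000, §1 (6) p. 6 and §6 p. 19 (Cauchy's inequality)] -/
theorem norm_sq_LhPQ_le_re (q : ℕ) [NeZero q] (P Q : ℝ[X]) (M : ℝ) :
    ‖LhPQ q P Q M‖ ^ 2 ≤
      (GL2Family.harmonicSum q 2 (fun _ ↦ (1 : ℂ))).re * (QhPQ q P Q M).re := by
  rw [harmonicSum_one_eq_ofReal, QhPQ_eq_ofReal, Complex.ofReal_re, Complex.ofReal_re]
  exact norm_sq_LhPQ_le q P Q M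

/-! ## Appendix (2026-08-28, cell ls-idea, lens-6 §v8c (c2) corollary — typer gen 2): the FLOOR on
the observed normalised second moment at `Q = 1` on the whole door window `0 < Δ' < 2`

From the kernel inequality `‖L^h‖² ≤ (Σ^h 1)·Re Q^h` above, the first display at `Q = 1`
(`firstDisplay_of_bettin`: `L^h(P,1;q̂^{Δ'}) = ζ(2)·(√q̂/(Δ' log q̂))·linForm(Δ',P,1) + O(√q̂/log²q̂)`,
itself conditional on the named fact `bettin2017_theorem11_primeLevel` and the main-term hypothesis
`MollifierMainTermAsymp P`) and the harmonic mass `Σ^h 1 = 1 + O(q^{−3/2})` (`kmv2000_eq4`, named fact),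
one gets, in the normalisation of `KMV2000.MomentAsymptotics` (`(L^h)² = ζ(2)² q̂/(Δ'² log² q̂)·linForm²`,
`ζ(2) = π²/6`):  `Re Q^h(P,1;q̂^{Δ'}) · Δ'² log² q̂ / (2ζ(2)² q̂) ≥ ½·linForm(Δ',P,1)² − ε` for every
`ε > 0` and all large prime `q` — lens-6's «T₂^{obs}(q) ≥ ½·linForm² − secondMomentForm − o(1)» after
subtracting `secondMomentForm(Δ',P,1)` from both sides. PROVED below (modulo the two named facts taken
as hypotheses); it is the LOWER side of K_A at main order and asserts nothing about zeros. -/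

/-- At weight `2` the two harmonic weights of the tree agree: `GL2Family.harmonicWeight f` (IK (14.60),
integer power `(4π)^{k−1}`) `= IwaniecSarnak.harmonicWeight f` (Conversations (7.3), real power).
[cite: IwaniecKowalski2004, (14.60)] -/
theorem harmonicWeight_two_eq_iwaniecSarnak {N : ℕ} [NeZero N] (f : CuspForm (Gamma0 N) 2) :
    GL2Family.harmonicWeight f = IwaniecSarnak.harmonicWeight f := by
  rw [GL2Family.harmonicWeight_def]
  unfold IwaniecSarnak.harmonicWeight
  norm_num

/-- The harmonic mass in the two vocabularies: `Re (Σ^h_f 1)` (GL2Family, complex) equals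
`IwaniecSarnak.harmonicSum q 2 (fun _ ↦ 1)` (real), the quantity of `kmv2000_eq4`.
[cite: IwaniecKowalski2004, (14.60)] -/
theorem re_harmonicSum_one_eq (q : ℕ) [NeZero q] :
    (GL2Family.harmonicSum q 2 (fun _ ↦ (1 : ℂ))).re =
      IwaniecSarnak.harmonicSum q 2 (fun _ ↦ (1 : ℝ)) := by
  rw [harmonicSum_one_eq_ofReal, Complex.ofReal_re]
  unfold IwaniecSarnak.harmonicSum
  refine finsum_congr fun f ↦ ?_
  refine finsum_congr fun _ ↦ ?_
  rw [harmonicWeight_two_eq_iwaniecSarnak, mul_one]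

/-- `Re Q^h(P,Q) ≥ 0` (a harmonic sum of `ω_f ‖·‖²` with `ω_f ≥ 0`).
[cite: KowalskiMichelVanderKam2000, §6 p. 19 (Q^h(P,Q))] -/
theorem re_QhPQ_nonneg (q : ℕ) [NeZero q] (P Q : ℝ[X]) (M : ℝ) : 0 ≤ (QhPQ q P Q M).re := by
  rw [QhPQ_eq_ofReal, Complex.ofReal_re]
  exact finsum_nonneg fun f ↦ finsum_nonneg fun _ ↦
    mul_nonneg (harmonicWeight_nonneg_two f) (sq_nonneg _)

/-- The real bookkeeping behind the floor: from `(A₀|ℓ| − A₀δ)² ≤ H·R` with `0 < H ≤ 1 + η`,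
`δ ≤ |ℓ|/2`, `2|ℓ|δ ≤ ε`, `ηℓ² ≤ ε` one gets `½ℓ² − ε ≤ R/(2A₀²)`. [folklore] -/
private theorem floor_algebra {ℓ δ η H R A₀ ε : ℝ} (hA₀ : 0 < A₀) (hH : 0 < H) (hHle : H ≤ 1 + η)
    (hη0 : 0 ≤ η) (hδ1 : δ ≤ |ℓ| / 2) (hδ2 : 2 * |ℓ| * δ ≤ ε) (hηε : η * ℓ ^ 2 ≤ ε)
    (hε : 0 < ε) (hR : (A₀ * |ℓ| - A₀ * δ) ^ 2 ≤ H * R) :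
    1 / 2 * ℓ ^ 2 - ε ≤ R * (1 / (2 * A₀ ^ 2)) := by
  have hℓabs : 0 ≤ |ℓ| := abs_nonneg ℓ
  have hsq : ℓ ^ 2 = |ℓ| ^ 2 := (sq_abs ℓ).symm
  have h1 : (|ℓ| - δ) ^ 2 / (2 * H) ≤ R * (1 / (2 * A₀ ^ 2)) := by
    rw [div_le_iff₀ (by positivity)]
    have e : R * (1 / (2 * A₀ ^ 2)) * (2 * H) = H * R / A₀ ^ 2 := by
      field_simp
    rw [e, le_div_iff₀ (by positivity)]
    calc (|ℓ| - δ) ^ 2 * A₀ ^ 2 = (A₀ * |ℓ| - A₀ * δ) ^ 2 := by ring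
      _ ≤ H * R := hR
  have hm0 : 0 ≤ ℓ ^ 2 - 2 * |ℓ| * δ := by
    rw [hsq]
    have : 2 * |ℓ| * δ ≤ |ℓ| * |ℓ| := by
      have := mul_le_mul_of_nonneg_left hδ1 hℓabs
      linarith
    nlinarith
  have h2 : ℓ ^ 2 - 2 * |ℓ| * δ ≤ (|ℓ| - δ) ^ 2 := by
    rw [hsq]; nlinarith [sq_nonneg δ]
  have h3 : (ℓ ^ 2 - 2 * |ℓ| * δ) / (2 * (1 + η)) ≤ (|ℓ| - δ) ^ 2 / (2 * H) :=
    calc (ℓ ^ 2 - 2 * |ℓ| * δ) / (2 * (1 + η)) ≤ (ℓ ^ 2 - 2 * |ℓ| * δ) / (2 * H) :=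
        div_le_div_of_nonneg_left hm0 (by positivity) (by linarith)
      _ ≤ (|ℓ| - δ) ^ 2 / (2 * H) := div_le_div_of_nonneg_right h2 (by positivity)
  have h4 : 1 / 2 * ℓ ^ 2 - ε ≤ (ℓ ^ 2 - 2 * |ℓ| * δ) / (2 * (1 + η)) := by
    rw [le_div_iff₀ (by positivity)]
    have e1 : ℓ ^ 2 * η ≤ ε := by rw [mul_comm]; exact hηε
    have e2 : 0 ≤ ε * η := mul_nonneg hε.le hη0
    have e3 : (1 / 2 * ℓ ^ 2 - ε) * (2 * (1 + η)) = ℓ ^ 2 + ℓ ^ 2 * η - 2 * ε - 2 * (ε * η) := by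
      ring
    rw [e3]
    linarith
  linarith

/-- **THE SECOND-MOMENT FLOOR at `Q = 1` on the whole door window** (lens-6 §v8c (c2) corollary, typed
AND proved modulo the named facts `bettin2017_theorem11_primeLevel`, `kmv2000_eq4` and the main-term
hypothesis `MollifierMainTermAsymp P`): for `0 < Δ' < 2` and every `ε > 0`, for all large prime `q`,
`Re Q^h(P, 1; q̂^{Δ'}) · Δ'² (log q̂)² / (2 (π²/6)² q̂) ≥ ½ · linForm(Δ', P, 1)² − ε`.
Equivalently `T₂^{obs}(q) := Re Q^h·Δ'²log²q̂/(2ζ(2)²q̂) − secondMomentForm ≥ ½ linForm² − secondMomentForm − ε`: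
the lower side of K_A's two-sided clause is free at main order (valueWith of the floor = 1). Proof:
reverse triangle on the first display, `‖L^h‖² ≤ (Σ^h 1) Re Q^h` (`norm_sq_LhPQ_le_re`),
`Σ^h 1 ≤ 1 + |C₄| q^{−3/2}`. Nothing about zeros is asserted.
[cite: KowalskiMichelVanderKam2000, §1 (6) p. 6, §6 p. 19 and Prop. 4.1 (case k = 0)] [cite: Bettin2017, Thm. 1.1] -/
theorem re_QhPQ_one_floor (hB : bettin2017_theorem11_primeLevel) {P : ℝ[X]}
    (hS : MollifierMainTermAsymp P) (h4 : kmv2000_eq4) {Δ : ℝ} (hΔ0 : 0 < Δ) (hΔ2 : Δ < 2)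
    {ε : ℝ} (hε : 0 < ε) :
    ∃ q₀ : ℕ, ∀ (q : ℕ) [NeZero q], q.Prime → q₀ ≤ q →
      (1 / 2) * (KMV2000.linForm Δ P 1) ^ 2 - ε ≤
        (QhPQ q P 1 (qhat q ^ Δ)).re * (Δ ^ 2 * Real.log (qhat q) ^ 2) /
          (2 * (π ^ 2 / 6) ^ 2 * qhat q) := by
  obtain ⟨C, q₁, hC⟩ := firstDisplay_of_bettin hB hS hΔ0 hΔ2
  obtain ⟨C₄, h4'⟩ := h4
  obtain ⟨ℓ, hℓdef⟩ : ∃ ℓ : ℝ, ℓ = KMV2000.linForm Δ P 1 := ⟨_, rfl⟩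
  rw [← hℓdef]
  obtain ⟨Cp, hCpdef⟩ : ∃ Cp : ℝ, Cp = max C 0 := ⟨_, rfl⟩
  have hCp0 : 0 ≤ Cp := by rw [hCpdef]; exact le_max_right _ _
  have hCle : C ≤ Cp := by rw [hCpdef]; exact le_max_left _ _
  have hz : (0 : ℝ) < π ^ 2 / 6 := by positivity
  -- the case ℓ = 0 is the non-negativity of Re Q^h
  by_cases hℓ0 : ℓ = 0
  · refine ⟨40, fun q _ _ hq ↦ ?_⟩
    have hqhat : 0 < qhat q := lt_trans one_pos (one_lt_qhat hq)
    have : 0 ≤ (QhPQ q P 1 (qhat q ^ Δ)).re * (Δ ^ 2 * Real.log (qhat q) ^ 2) /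
        (2 * (π ^ 2 / 6) ^ 2 * qhat q) :=
      div_nonneg (mul_nonneg (re_QhPQ_nonneg q P 1 _) (by positivity)) (by positivity)
    rw [hℓ0]; linarith
  have hℓpos : 0 < |ℓ| := abs_pos.mpr hℓ0
  -- thresholds
  obtain ⟨X₀, hX₀def⟩ : ∃ X₀ : ℝ,
      X₀ = max 1 (max (2 * Cp * Δ / ((π ^ 2 / 6) * |ℓ|)) (2 * |ℓ| * Cp * Δ / ((π ^ 2 / 6) * ε))) :=
    ⟨_, rfl⟩
  obtain ⟨N₁, hN₁⟩ := exists_log_qhat_ge X₀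
  obtain ⟨N₂, hN₂def⟩ : ∃ N₂ : ℕ, N₂ = ⌈max (2 * |C₄|) (|C₄| * ℓ ^ 2 / ε)⌉₊ := ⟨_, rfl⟩
  refine ⟨max (max q₁ N₁) (max N₂ 300), fun q _ hq hq₀ ↦ ?_⟩
  have hq₁ : q₁ ≤ q := le_trans (le_trans (le_max_left _ _) (le_max_left _ _)) hq₀
  have hqN₁ : N₁ ≤ q := le_trans (le_trans (le_max_right _ _) (le_max_left _ _)) hq₀
  have hqN₂ : N₂ ≤ q := le_trans (le_trans (le_max_left _ _) (le_max_right _ _)) hq₀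
  have hq300 : 300 ≤ q := le_trans (le_trans (le_max_right _ _) (le_max_right _ _)) hq₀
  have hqR : (1 : ℝ) ≤ q := by exact_mod_cast le_trans (by norm_num) hq300
  have hqpos : (0 : ℝ) < q := by linarith
  have hqhat1 : 1 < qhat q := one_lt_qhat (le_trans (by norm_num) hq300)
  have hqhat0 : 0 < qhat q := lt_trans one_pos hqhat1
  obtain ⟨x, hxdef⟩ : ∃ x : ℝ, x = Real.log (qhat q) := ⟨_, rfl⟩
  have hx1 : 1 ≤ x := by rw [hxdef]; exact one_le_log_qhat hq300
  have hx0 : 0 < x := by linarith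
  have hxX : X₀ ≤ x := by rw [hxdef]; exact hN₁ q hqN₁
  obtain ⟨s, hsdef⟩ : ∃ s : ℝ, s = Real.sqrt (qhat q) := ⟨_, rfl⟩
  have hs0 : 0 < s := by rw [hsdef]; exact Real.sqrt_pos.mpr hqhat0
  have hs2 : s ^ 2 = qhat q := by rw [hsdef, Real.sq_sqrt hqhat0.le]
  rw [← hxdef]
  -- A₀ = (π²/6) s/(Δ x), the main-term scale; δ = Cp Δ/((π²/6) x)
  obtain ⟨A₀, hA₀def⟩ : ∃ A₀ : ℝ, A₀ = (π ^ 2 / 6) * (s / (Δ * x)) := ⟨_, rfl⟩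
  have hA₀pos : 0 < A₀ := by rw [hA₀def]; positivity
  obtain ⟨δ, hδdef⟩ : ∃ δ : ℝ, δ = Cp * Δ / ((π ^ 2 / 6) * x) := ⟨_, rfl⟩
  have hδ0 : 0 ≤ δ := by rw [hδdef]; positivity
  -- δ ≤ |ℓ|/2 and 2|ℓ|δ ≤ ε from x ≥ X₀
  have hX1 : 2 * Cp * Δ / ((π ^ 2 / 6) * |ℓ|) ≤ x :=
    le_trans (le_trans (le_max_left _ _) (le_max_right _ _)) (hX₀def ▸ hxX)
  have hX2 : 2 * |ℓ| * Cp * Δ / ((π ^ 2 / 6) * ε) ≤ x :=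
    le_trans (le_trans (le_max_right _ _) (le_max_right _ _)) (hX₀def ▸ hxX)
  rw [div_le_iff₀ (by positivity)] at hX1 hX2
  have hδ1 : δ ≤ |ℓ| / 2 := by
    rw [hδdef, div_le_iff₀ (by positivity)]
    have e : |ℓ| / 2 * (π ^ 2 / 6 * x) = x * (π ^ 2 / 6 * |ℓ|) / 2 := by ring
    rw [e]; linarith
  have hδ2 : 2 * |ℓ| * δ ≤ ε := by
    have e : 2 * |ℓ| * δ = 2 * |ℓ| * Cp * Δ / (π ^ 2 / 6 * x) := by rw [hδdef]; ring
    rw [e, div_le_iff₀ (by positivity)]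
    have e' : ε * (π ^ 2 / 6 * x) = x * (π ^ 2 / 6 * ε) := by ring
    rw [e']; exact hX2
  -- harmonic mass: H = Re Σ^h 1, |H − 1| ≤ η := |C₄| q^{-3/2} ≤ min (1/2) (ε/ℓ²)
  obtain ⟨H, hHdef⟩ : ∃ H : ℝ, H = (GL2Family.harmonicSum q 2 (fun _ ↦ (1 : ℂ))).re := ⟨_, rfl⟩
  obtain ⟨η, hηdef⟩ : ∃ η : ℝ, η = |C₄| * (q : ℝ) ^ (-(3 / 2 : ℝ)) := ⟨_, rfl⟩
  have hH4 : |H - 1| ≤ η := by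
    rw [hHdef, re_harmonicSum_one_eq, hηdef]
    refine le_trans (h4' q hq) ?_
    exact mul_le_mul_of_nonneg_right (le_abs_self _) (Real.rpow_nonneg hqpos.le _)
  have hη0 : 0 ≤ η := by rw [hηdef]; positivity
  have hqpow : (q : ℝ) ^ (-(3 / 2 : ℝ)) ≤ (q : ℝ)⁻¹ := by
    rw [Real.rpow_neg hqpos.le]
    apply inv_anti₀ hqpos
    calc (q : ℝ) = (q : ℝ) ^ (1 : ℝ) := (Real.rpow_one _).symm
      _ ≤ (q : ℝ) ^ (3 / 2 : ℝ) := Real.rpow_le_rpow_of_exponent_le hqR (by norm_num)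
  have hηle : η ≤ |C₄| / q := by
    rw [hηdef, div_eq_mul_inv]
    exact mul_le_mul_of_nonneg_left hqpow (abs_nonneg _)
  have hN₂le : max (2 * |C₄|) (|C₄| * ℓ ^ 2 / ε) ≤ (q : ℝ) := by
    have h1 : max (2 * |C₄|) (|C₄| * ℓ ^ 2 / ε) ≤ (N₂ : ℝ) := by rw [hN₂def]; exact Nat.le_ceil _
    exact h1.trans (by exact_mod_cast hqN₂)
  have hη_half : η ≤ 1 / 2 := by
    have h1 : 2 * |C₄| ≤ (q : ℝ) := le_trans (le_max_left _ _) hN₂le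
    have h2 : |C₄| / q ≤ 1 / 2 := by
      rw [div_le_iff₀ hqpos]; linarith
    linarith
  have hη_eps : η * ℓ ^ 2 ≤ ε := by
    have h1 : |C₄| * ℓ ^ 2 / ε ≤ (q : ℝ) := le_trans (le_max_right _ _) hN₂le
    rw [div_le_iff₀ hε] at h1
    have h2 : |C₄| / q * ℓ ^ 2 ≤ ε := by
      rw [div_mul_eq_mul_div, div_le_iff₀ hqpos]; linarith
    exact le_trans (mul_le_mul_of_nonneg_right hηle (sq_nonneg _)) h2
  have hHle : H ≤ 1 + η := by
    have := (abs_le.mp hH4).2; linarith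
  have hHpos : 0 < H := by
    have := (abs_le.mp hH4).1; linarith
  -- the first display, reverse triangle: ‖L‖ ≥ A₀|ℓ| − A₀ δ
  have hdisp := hC q hq hq₁
  rw [riemannZeta_two, ← hxdef, ← hsdef, ← hℓdef, add_zero] at hdisp
  have hmain_eq : ((π : ℂ) ^ 2 / 6 * ((s / (Δ * x) : ℝ) : ℂ)) * ((ℓ : ℝ) : ℂ) =
      ((A₀ * ℓ : ℝ) : ℂ) := by
    rw [hA₀def]; push_cast; ring
  rw [hmain_eq] at hdisp
  have hnorm_main : ‖((A₀ * ℓ : ℝ) : ℂ)‖ = A₀ * |ℓ| := by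
    rw [Complex.norm_real, Real.norm_eq_abs, abs_mul, abs_of_pos hA₀pos]
  have herr : C * s * x⁻¹ ^ 2 ≤ A₀ * δ := by
    have h1 : C * s * x⁻¹ ^ 2 ≤ Cp * s * x⁻¹ ^ 2 := by
      apply mul_le_mul_of_nonneg_right _ (by positivity)
      exact mul_le_mul_of_nonneg_right hCle hs0.le
    have h2 : A₀ * δ = Cp * s * x⁻¹ ^ 2 := by
      rw [hA₀def, hδdef]; field_simp
    linarith
  have hLge : A₀ * |ℓ| - A₀ * δ ≤ ‖LhPQ q P 1 (qhat q ^ Δ)‖ := by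
    have htri := norm_sub_norm_le ((A₀ * ℓ : ℝ) : ℂ) (LhPQ q P 1 (qhat q ^ Δ))
    rw [hnorm_main, norm_sub_rev] at htri
    linarith
  have hLge0 : 0 ≤ A₀ * |ℓ| - A₀ * δ := by
    have : δ ≤ |ℓ| := by linarith
    have := mul_le_mul_of_nonneg_left this hA₀pos.le
    linarith
  -- the floor: ‖L‖² ≤ H · Re Q
  have hfloor := norm_sq_LhPQ_le_re q P 1 (qhat q ^ Δ)
  rw [← hHdef] at hfloor
  have hsq : (A₀ * |ℓ| - A₀ * δ) ^ 2 ≤ H * (QhPQ q P 1 (qhat q ^ Δ)).re :=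
    le_trans (pow_le_pow_left₀ hLge0 hLge 2) hfloor
  -- normalisation: Δ² x²/(2 (π²/6)² q̂) = 1/(2 A₀²)
  have hnormeq : (QhPQ q P 1 (qhat q ^ Δ)).re * (Δ ^ 2 * x ^ 2) / (2 * (π ^ 2 / 6) ^ 2 * qhat q) =
      (QhPQ q P 1 (qhat q ^ Δ)).re * (1 / (2 * A₀ ^ 2)) := by
    rw [hA₀def, ← hs2]
    field_simp
  rw [hnormeq]
  exact floor_algebra hA₀pos hHpos hHle hη0 hδ1 hδ2 hη_eps hε hsq

end Literature.NumberTheory.LFunctions.KMV2000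

end
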